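import Literature.Geometry.Kaehler.ComplexTorusAnalyticCycleClassBoundedVolume
import Literature.Geometry.Kaehler.ComplexTorusAnalyticCycleClassPushforward
import Literature.Geometry.Kaehler.ComplexTorusMapsLinear
import HarnessLib

/-!
# Bishop's theorem on a complex torus: limits of analytic subsets of bounded volume are analytic

Layer `Literature/Geometry/Kaehler`; lane `lit-hodgefound`, seat p07, programme «BOUNDED CYCLES ON A
COMPLEX TORUS», file 4. Let `X = E/Λ` (`Λ = Φ(ℤ^ι)`, `π : E → X` the covering map) be a complex torus.
By `ComplexTorusAnalyticCycleClassBoundedVolume.lean` ([Chirka1989, §16.1 Prop. 1 (2)]) a sequence of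
analytic subsets `Z_j ⊆ X` of pure dimension `p = d + 1` with bounded volumes has a subsequence whose
lifted currents `[π⁻¹ Z_j]` converge to a positive holomorphic `p`-chain `T` on `E`. This file DESCENDS
the limit to the torus:

* §1 (descent of `Λ`-periodic subsets of `E`) `ComplexTorus.liftSet_image_cover_of_periodic` — for a
  `Λ`-periodic `S ⊆ E` and `W = π(S)`: `π⁻¹ W = S`; `isClosed_image_cover_of_periodic`,
  `isAnalyticSet_of_isAnalyticSet_liftSet`, `hasPureDim_of_hasPureDim_liftSet` — `W` is closed ∕
  analytic ∕ of pure dimension `p` when `S` is (`π` is an open quotient map and a local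
  biholomorphism: tree `isOpenQuotientMap_cover`, `isAnalyticSet_cover_preimage_iff`,
  `isRegularPointOfCodim_liftSet_iff`) [Lange2023AbelianVarietiesComplex, §1.1.4; Chirka1989, §2.3];
* §2 (the limit set) for `[π⁻¹ Z_j] → [T]`: `translateTop_preimage_support_of_tendsto` — `|T|` is
  `Λ`-periodic (it is the limit set of the periodic sets `π⁻¹ Z_j`, [Chirka1989, §16.1 Prop. 1]); with
  `W = π(|T|)`: `liftSet_image_cover_support` (`π⁻¹ W = |T|`), **`isAnalyticSet_image_cover_support`**,
  **`image_cover_support_eq_empty_or_hasPureDim`** (`W` is a closed analytic subset of `X`, empty or of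
  pure dimension `p` — BISHOP'S THEOREM [Chirka1989, §15.5 Thm.] on the compact torus);
  **`mem_image_cover_support_iff_of_tendsto`** (`W` is the limit set of `{Z_j}`: `z ∈ W` iff every
  `cl(⋃_{j ≥ N} Z_j)` contains `z`), **`eventually_nonempty_inter_of_tendsto`** (every neighbourhood of a
  point of `W` meets `Z_j` for all large `j`), **`eventually_subset_of_isOpen_of_tendsto`** (every open
  `U ⊇ W` contains `Z_j` for all large `j`; `X` is compact) — i.e. `Z_j → W` in the Hausdorff ∕
  Kuratowski sense [Chirka1989, §15.5, p. 203: `A_j → A`];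
* §3 **`exists_subseq_tendsto_analyticSet_of_measure_le`** — the packaged statement: analytic subsets
  `Z_j ⊆ X` of pure dimension `p = d + 1` with `𝓗^{2p}(π⁻¹Z_j ∩ Φ([0,1)^ι)) ≤ M < ∞` have a subsequence
  converging in this sense to a closed analytic `W ⊆ X`, empty or of pure dimension `p`, along which the
  classes `[Z_j] ∈ H^k(X, ℂ)` are eventually constant [Fujiki1978, §2 Prop. 2.10, §4 Prop. 4.1].

Theorems only; no new definitions, no named facts.

## References

* [Chirka1989] E. M. Chirka, *Complex Analytic Sets*, Kluwer 1989, §2.3, §15.5 Thm. (p. 202) and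
  p. 205, §16.1 Prop. 1 (pp. 206–207).
* [Fujiki1978] A. Fujiki, *Closedness of the Douady spaces of compact Kähler spaces*, Publ. RIMS 14
  (1978) 1–52, §2 Prop. 2.10, §4 Prop. 4.1.
* [Lange2023AbelianVarietiesComplex] H. Lange, *Abelian Varieties over the Complex Numbers*, Springer
  2023, §1.1.4.
* [LangeBirkenhake1992] H. Lange, Ch. Birkenhake, *Complex Abelian Varieties*, Springer 1992,
  Lemma 1.1.3.
-/

noncomputable section

open scoped Manifold ENNReal NNReal Topology
open MeasureTheory TopologicalSpace Set Function Filter Metric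
open Literature.Geometry.GeometricMeasureTheory

namespace Literature.Geometry.Kaehler

-- Nested operator-norm instances on `Covector V m` / `Multivector V m`, as in `Currents.lean`.
set_option maxSynthPendingDepth 2

universe u

namespace ComplexTorus

/-! ## §1. Descent of `Λ`-periodic subsets of `E` to the torus -/

section Descent

variable {ι : Type*} {E : Type u} [NormedAddCommGroup E] [NormedSpace ℂ E] (Φ : (ι → ℝ) ≃L[ℝ] E)

/-- **`π⁻¹(π(S)) = S` for a `Λ`-periodic subset `S`** (of the manifold `⊤ : Opens E`): the fibres of
`π` are the `Λ`-cosets. [cite: LangeBirkenhake1992, Lemma 1.1.3] -/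
theorem liftSet_image_cover_of_periodic {S : Set (⊤ : Opens E)}
    (hS : ∀ m : ι → ℤ, translateTop (latticeVec Φ m) ⁻¹' S = S) :
    liftSet Φ (cover Φ '' (((↑) : (⊤ : Opens E) → E) '' S)) = S := by
  ext x
  rw [mem_liftSet_iff]
  constructor
  · rintro ⟨_, ⟨y, hy, rfl⟩, hxy⟩
    obtain ⟨m, hm⟩ := (cover_eq_cover_iff Φ (x : E) (y : E)).1 hxy.symm
    have hx : x = translateTop (latticeVec Φ m) y :=
      Subtype.ext (by rw [coe_translateTop, hm, add_comm])
    have hy' : y ∈ translateTop (latticeVec Φ m) ⁻¹' S := by rw [hS]; exact hy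
    rw [hx]
    exact hy'
  · intro hx
    exact ⟨x, ⟨x, hx, rfl⟩, rfl⟩

omit [NormedSpace ℂ E] in
/-- The image in `E` of a subset of `⊤ : Opens E` is its image under `topHomeomorph`. [cite: Chirka1989, §2.3] -/
theorem image_val_eq_image_topHomeomorph (S : Set (⊤ : Opens E)) :
    ((↑) : (⊤ : Opens E) → E) '' S = topHomeomorph '' S := rfl

/-- **`π(S)` is closed for a closed `Λ`-periodic `S`** (`π` is a quotient map and `π⁻¹(π(S)) = S`).
[cite: LangeBirkenhake1992, Lemma 1.1.3] -/
theorem isClosed_image_cover_of_periodic {S : Set (⊤ : Opens E)}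
    (hS : ∀ m : ι → ℤ, translateTop (latticeVec Φ m) ⁻¹' S = S) (hc : IsClosed S) :
    IsClosed (cover Φ '' (((↑) : (⊤ : Opens E) → E) '' S)) := by
  rw [← (isOpenQuotientMap_cover (Φ := Φ)).isQuotientMap.isClosed_preimage, ← image_val_liftSet,
    liftSet_image_cover_of_periodic Φ hS, image_val_eq_image_topHomeomorph]
  exact topHomeomorph.isClosed_image.2 hc

variable [Fintype ι]

/-- **`Z` is analytic if `π⁻¹ Z` is** (`π` is a local biholomorphism; the lift is taken in the manifold
`⊤ : Opens E`). [cite: Chirka1989, §2.3] -/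
theorem isAnalyticSet_of_isAnalyticSet_liftSet {Z : Set (ComplexTorus Φ)}
    (hZ : IsAnalyticSet 𝓘(ℂ, E) (liftSet Φ Z)) : IsAnalyticSet 𝓘(ℂ, E) Z := by
  rw [← isAnalyticSet_cover_preimage_iff Φ]
  have h := IsAnalyticSet.image_symm_homeomorph (I := 𝓘(ℂ, E)) (I' := 𝓘(ℂ, E)) topHomeomorph.symm
    mdifferentiable_topHomeomorph_symm hZ
  rw [Homeomorph.symm_symm, liftSet_eq_preimage, Homeomorph.image_preimage] at h
  exact h

/-- **`Z` has pure dimension `p` if `π⁻¹ Z` has** (regular points and their codimensions correspond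
under `π`). [cite: Chirka1989, §2.3] -/
theorem hasPureDim_of_hasPureDim_liftSet {Z : Set (ComplexTorus Φ)} {p : ℕ}
    (hZ : HasPureDim 𝓘(ℂ, E) (liftSet Φ Z) p) : HasPureDim 𝓘(ℂ, E) Z p := by
  obtain ⟨c, hpc, hZa, hZne, hZreg⟩ := hZ
  refine ⟨c, hpc, isAnalyticSet_of_isAnalyticSet_liftSet Φ hZa, ?_, fun y hy ↦ ?_⟩
  · obtain ⟨x, hx⟩ := hZne
    exact ⟨cover Φ x, hx⟩
  · obtain ⟨x, rfl⟩ := cover_surjective Φ y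
    have hx : (⟨x, trivial⟩ : (⊤ : Opens E)) ∈ regularLocus 𝓘(ℂ, E) (liftSet Φ Z) :=
      (mem_regularLocus_liftSet_iff Φ _).2 hy
    exact (isRegularPointOfCodim_liftSet_iff Φ _).1 (hZreg _ hx)

/-- **A closed `Λ`-periodic analytic subset of `E` of pure dimension `p` descends to a closed analytic
subset of `X` of pure dimension `p`** with lift the given set. [cite: Lange2023AbelianVarietiesComplex, §1.1.4; Chirka1989, §2.3] -/
theorem hasPureDim_image_cover_of_periodic {S : Set (⊤ : Opens E)} {p : ℕ}
    (hS : ∀ m : ι → ℤ, translateTop (latticeVec Φ m) ⁻¹' S = S) (hSp : HasPureDim 𝓘(ℂ, E) S p) :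
    HasPureDim 𝓘(ℂ, E) (cover Φ '' (((↑) : (⊤ : Opens E) → E) '' S)) p :=
  hasPureDim_of_hasPureDim_liftSet Φ (by rw [liftSet_image_cover_of_periodic Φ hS]; exact hSp)

end Descent

/-! ## §2. The limit of a weakly convergent sequence of analytic subsets of the torus -/

section Limit

variable {ι : Type*} [Fintype ι] {E : Type u} [NormedAddCommGroup E] [InnerProductSpace ℂ E]
  [FiniteDimensional ℂ E] [MeasurableSpace E] [BorelSpace E] (Φ : (ι → ℝ) ≃L[ℝ] E) {d : ℕ}
  {Z : ℕ → Set (ComplexTorus Φ)} (hZ : ∀ j, HasPureDim 𝓘(ℂ, E) (Z j) (d + 1))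
  {T : HolomorphicChain 𝓘(ℂ, E) (⊤ : Opens E) (d + 1)}

omit [Fintype ι] [FiniteDimensional ℂ E] [MeasurableSpace E] [BorelSpace E] in
/-- The tail unions `⋃_{j ≥ N} π⁻¹ Z_j ⊆ E` are `Λ`-periodic, and so are their closures.
[cite: Lange2023AbelianVarietiesComplex, §1.1.4] -/
theorem latticeVec_add_mem_closure_iUnion_iff (m : ι → ℤ) (N : ℕ) (x : E) :
    latticeVec Φ m + x ∈ closure (⋃ j ≥ N, (((↑) : (⊤ : Opens E) → E) '' liftSet Φ (Z j) : Set E)) ↔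
      x ∈ closure (⋃ j ≥ N, (((↑) : (⊤ : Opens E) → E) '' liftSet Φ (Z j) : Set E)) := by
  set D : Set E := ⋃ j ≥ N, (((↑) : (⊤ : Opens E) → E) '' liftSet Φ (Z j) : Set E) with hD
  have hinv : (Homeomorph.addLeft (latticeVec Φ m)) ⁻¹' D = D := by
    simp only [hD, preimage_iUnion, image_val_liftSet]
    refine iUnion_congr fun j ↦ iUnion_congr fun _ ↦ ?_
    exact const_add_preimage_cover_preimage Φ (Z j) m
  have h : (Homeomorph.addLeft (latticeVec Φ m)) ⁻¹' closure D = closure D := by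
    rw [Homeomorph.preimage_closure, hinv]
  conv_rhs => rw [← h]
  rfl

/-- **The support of the limit chain is `Λ`-periodic**: if `[π⁻¹ Z_j] → [T]` in the sense of currents
then `|T| + λ = |T|` for every `λ ∈ Λ` (`|T|` is the limit set of the periodic sets `π⁻¹ Z_j`).
[cite: Chirka1989, §16.1 Prop. 1, p. 207; Lange2023AbelianVarietiesComplex, §1.1.4] -/
theorem translateTop_preimage_support_of_tendsto
    (hconv : ∀ ψ, Tendsto (fun j ↦ (analyticChain Φ (hZ j)).toCurrent ψ) atTop (𝓝 (T.toCurrent ψ)))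
    (m : ι → ℤ) : translateTop (latticeVec Φ m) ⁻¹' T.support = T.support := by
  have key : ∀ x : (⊤ : Opens E), x ∈ T.support ↔
      ∀ N : ℕ, (x : E) ∈ closure (⋃ j ≥ N, (((↑) : (⊤ : Opens E) → E) '' liftSet Φ (Z j) : Set E)) := by
    intro x
    rw [← mem_image_support_iff_of_tendsto_ofSet (fun j ↦ hasPureDim_liftSet Φ (hZ j)) hconv x.2]
    exact ⟨fun hx ↦ ⟨x, hx, rfl⟩, fun ⟨y, hy, hyx⟩ ↦ by rwa [← Subtype.ext hyx]⟩
  ext x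
  rw [mem_preimage, key, key, coe_translateTop]
  exact forall_congr' fun N ↦ latticeVec_add_mem_closure_iUnion_iff Φ m N (x : E)

/-- **`π⁻¹(π(|T|)) = |T|`** for the limit chain. [cite: LangeBirkenhake1992, Lemma 1.1.3] -/
theorem liftSet_image_cover_support
    (hconv : ∀ ψ, Tendsto (fun j ↦ (analyticChain Φ (hZ j)).toCurrent ψ) atTop (𝓝 (T.toCurrent ψ))) :
    liftSet Φ (cover Φ '' (((↑) : (⊤ : Opens E) → E) '' T.support)) = T.support :=
  liftSet_image_cover_of_periodic Φ (translateTop_preimage_support_of_tendsto Φ hZ hconv)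

/-- **The limit `W = π(|T|)` is a closed subset of `X`.** [cite: Chirka1989, §15.5 Thm., p. 202] -/
theorem isClosed_image_cover_support
    (hconv : ∀ ψ, Tendsto (fun j ↦ (analyticChain Φ (hZ j)).toCurrent ψ) atTop (𝓝 (T.toCurrent ψ))) :
    IsClosed (cover Φ '' (((↑) : (⊤ : Opens E) → E) '' T.support)) :=
  haveI : LocallyCompactSpace (⊤ : Opens E) := (⊤ : Opens E).isOpen.locallyCompactSpace
  isClosed_image_cover_of_periodic Φ (translateTop_preimage_support_of_tendsto Φ hZ hconv)
    T.isAnalyticSet_support.isClosed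

/-- **BISHOP'S THEOREM ON THE TORUS — the limit `W = π(|T|)` is an analytic subset of `X`.**
[cite: Chirka1989, §15.5 Thm., p. 202; §16.1 Prop. 1, p. 207] -/
theorem isAnalyticSet_image_cover_support
    (hconv : ∀ ψ, Tendsto (fun j ↦ (analyticChain Φ (hZ j)).toCurrent ψ) atTop (𝓝 (T.toCurrent ψ))) :
    IsAnalyticSet 𝓘(ℂ, E) (cover Φ '' (((↑) : (⊤ : Opens E) → E) '' T.support)) := by
  haveI : LocallyCompactSpace (⊤ : Opens E) := (⊤ : Opens E).isOpen.locallyCompactSpace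
  refine isAnalyticSet_of_isAnalyticSet_liftSet Φ ?_
  rw [liftSet_image_cover_support Φ hZ hconv]
  exact T.isAnalyticSet_support

/-- **… and it is either empty or of pure dimension `p = d + 1`** (the dimension of the `Z_j`).
[cite: Chirka1989, §15.5 Thm., p. 202; §16.1 Prop. 1, p. 207] -/
theorem image_cover_support_eq_empty_or_hasPureDim
    (hconv : ∀ ψ, Tendsto (fun j ↦ (analyticChain Φ (hZ j)).toCurrent ψ) atTop (𝓝 (T.toCurrent ψ))) :
    cover Φ '' (((↑) : (⊤ : Opens E) → E) '' T.support) = ∅ ∨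
      HasPureDim 𝓘(ℂ, E) (cover Φ '' (((↑) : (⊤ : Opens E) → E) '' T.support)) (d + 1) := by
  rcases T.support.eq_empty_or_nonempty with h | h
  · left
    rw [h, image_empty, image_empty]
  · right
    exact hasPureDim_image_cover_of_periodic Φ (translateTop_preimage_support_of_tendsto Φ hZ hconv)
      (T.hasPureDim_support h)

/-- **`W = π(|T|)` is the limit set of `{Z_j}` in `X`**: `z ∈ W` iff `z ∈ cl(⋃_{j ≥ N} Z_j)` for every
`N` (the limit set of the lifts is `|T|`, [Chirka1989, §16.1 Prop. 1]; `π` is an open map).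
[cite: Chirka1989, §15.5, p. 205; §16.1 Prop. 1, p. 207] -/
theorem mem_image_cover_support_iff_of_tendsto
    (hconv : ∀ ψ, Tendsto (fun j ↦ (analyticChain Φ (hZ j)).toCurrent ψ) atTop (𝓝 (T.toCurrent ψ)))
    (z : ComplexTorus Φ) :
    z ∈ cover Φ '' (((↑) : (⊤ : Opens E) → E) '' T.support) ↔ ∀ N : ℕ, z ∈ closure (⋃ j ≥ N, Z j) := by
  -- upstairs: the limit set of the lifts
  have key : ∀ x : E, x ∈ ((↑) : (⊤ : Opens E) → E) '' T.support ↔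
      ∀ N : ℕ, x ∈ closure (⋃ j ≥ N, (((↑) : (⊤ : Opens E) → E) '' liftSet Φ (Z j) : Set E)) :=
    fun x ↦ mem_image_support_iff_of_tendsto_ofSet (fun j ↦ hasPureDim_liftSet Φ (hZ j)) hconv trivial
  -- the tail unions upstairs are the preimages of the tail unions downstairs, and so are the closures
  have hpre : ∀ N : ℕ, closure (⋃ j ≥ N, (((↑) : (⊤ : Opens E) → E) '' liftSet Φ (Z j) : Set E)) =
      cover Φ ⁻¹' closure (⋃ j ≥ N, Z j) := by
    intro N
    rw [(isOpenQuotientMap_cover (Φ := Φ)).isOpenMap.preimage_closure_eq_closure_preimage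
      (continuous_cover Φ), preimage_iUnion₂]
    simp only [image_val_liftSet]
  constructor
  · rintro ⟨x, hx, rfl⟩ N
    have h := (key x).1 hx N
    rwa [hpre N] at h
  · intro h
    obtain ⟨x, rfl⟩ := cover_surjective Φ z
    exact ⟨x, (key x).2 fun N ↦ by rw [hpre N]; exact h N, rfl⟩

/-- **Every neighbourhood of a point of `W` meets `Z_j` for all large `j`** (`|T|` lies in the
`ε`-neighbourhood of `π⁻¹ Z_j` for large `j`, [Chirka1989, §16.1 Prop. 1]).
[cite: Chirka1989, §15.5, p. 205; §16.1 Prop. 1, p. 207] -/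
theorem eventually_nonempty_inter_of_tendsto
    (hconv : ∀ ψ, Tendsto (fun j ↦ (analyticChain Φ (hZ j)).toCurrent ψ) atTop (𝓝 (T.toCurrent ψ)))
    {z : ComplexTorus Φ} (hz : z ∈ cover Φ '' (((↑) : (⊤ : Opens E) → E) '' T.support))
    {V : Set (ComplexTorus Φ)} (hV : V ∈ 𝓝 z) : ∀ᶠ j in atTop, (Z j ∩ V).Nonempty := by
  obtain ⟨x, hx, rfl⟩ := hz
  obtain ⟨ε, hε, hball⟩ := Metric.mem_nhds_iff.1 ((continuous_cover Φ).continuousAt.preimage_mem_nhds hV)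
  have h := eventually_subset_thickening_of_tendsto_ofSet (fun j ↦ hasPureDim_liftSet Φ (hZ j)) hconv
    isCompact_singleton (singleton_subset_iff.2 hx) hε
  filter_upwards [h] with j hj
  obtain ⟨a, ha, hxa⟩ := mem_thickening_iff.1 (hj (mem_singleton x))
  rw [image_val_liftSet] at ha
  exact ⟨cover Φ a, ha, hball (mem_ball'.2 hxa)⟩

/-- **Every open `U ⊇ W` contains `Z_j` for all large `j`** (`X` is compact: a sequence of points
`z_j ∈ Z_j ∖ U` would accumulate at a point of the limit set `W` outside `U`).
[cite: Chirka1989, §15.5, p. 205; §16.1 Prop. 1, p. 207] -/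
theorem eventually_subset_of_isOpen_of_tendsto
    (hconv : ∀ ψ, Tendsto (fun j ↦ (analyticChain Φ (hZ j)).toCurrent ψ) atTop (𝓝 (T.toCurrent ψ)))
    {U : Set (ComplexTorus Φ)} (hU : IsOpen U)
    (hWU : cover Φ '' (((↑) : (⊤ : Opens E) → E) '' T.support) ⊆ U) : ∀ᶠ j in atTop, Z j ⊆ U := by
  by_contra hcon
  rw [not_eventually] at hcon
  -- points `z N ∈ Z (φ N) \ U` with `φ N ≥ N`
  have hch : ∀ N : ℕ, ∃ j, N ≤ j ∧ ∃ z ∈ Z j, z ∉ U := by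
    intro N
    obtain ⟨j, hj, hjU⟩ := (frequently_atTop.1 hcon) N
    obtain ⟨z, hz, hzU⟩ := not_subset.1 hjU
    exact ⟨j, hj, z, hz, hzU⟩
  choose φ hφ z hz hzU using hch
  -- a convergent subsequence in the compact `Uᶜ`
  obtain ⟨w, hwU, ψ, hψ, hlim⟩ := hU.isClosed_compl.isCompact.tendsto_subseq (x := z) fun N ↦ hzU N
  -- its limit lies in the limit set `W ⊆ U`
  have hwW : w ∈ cover Φ '' (((↑) : (⊤ : Opens E) → E) '' T.support) := by
    rw [mem_image_cover_support_iff_of_tendsto Φ hZ hconv]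
    intro N
    refine mem_closure_of_tendsto hlim (eventually_atTop.2 ⟨N, fun i hi ↦ ?_⟩)
    have hi' : N ≤ φ (ψ i) := (hi.trans (hψ.id_le i)).trans (hφ (ψ i))
    exact mem_iUnion₂.2 ⟨φ (ψ i), hi', hz (ψ i)⟩
  exact hwU (hWU hwW)

end Limit

/-! ## §3. The packaged compactness statement -/

section Package

variable {ι : Type*} [Fintype ι] [DecidableEq ι] {E : Type u} [NormedAddCommGroup E]
  [InnerProductSpace ℂ E] [FiniteDimensional ℂ E] [MeasurableSpace E] [BorelSpace E]
  (Φ : (ι → ℝ) ≃L[ℝ] E) {d n k : ℕ} (e : Fin n ≃ ι) (h : 2 * (d + 1) + k = n)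

/-- **BISHOP'S THEOREM ON A COMPLEX TORUS, WITH CLASSES.** Let `Z_j ⊆ X = E/Λ` be analytic subsets of
pure dimension `p = d + 1` with `𝓗^{2p}(π⁻¹Z_j ∩ Φ([0,1)^ι)) ≤ M < ∞`. Then there are a subsequence
`κ` and a CLOSED ANALYTIC `W ⊆ X`, empty or of pure dimension `p`, such that `Z_{κ j} → W`: `W` is the
limit set of `{Z_{κ j}}`, every neighbourhood of a point of `W` meets `Z_{κ j}` for all large `j`, every
open `U ⊇ W` contains `Z_{κ j}` for all large `j`; and the classes `[Z_{κ j}] ∈ H^k(X, ℂ)` are eventually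
constant. [cite: Chirka1989, §15.5 Thm. and p. 205, §16.1 Prop. 1; Fujiki1978, §2 Prop. 2.10, §4 Prop. 4.1] -/
theorem exists_subseq_tendsto_analyticSet_of_measure_le {Z : ℕ → Set (ComplexTorus Φ)}
    (hZ : ∀ j, HasPureDim 𝓘(ℂ, E) (Z j) (d + 1)) {M : ℝ≥0∞} (hM : M < ⊤)
    (hvol : ∀ j, (μHE[2 * (d + 1)] : Measure E) (cover Φ ⁻¹' Z j ∩ periodBox Φ 0) ≤ M) :
    ∃ (κ : ℕ → ℕ) (W : Set (ComplexTorus Φ)), StrictMono κ ∧ IsClosed W ∧ IsAnalyticSet 𝓘(ℂ, E) W ∧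
      (W = ∅ ∨ HasPureDim 𝓘(ℂ, E) W (d + 1)) ∧
      (∀ z, z ∈ W ↔ ∀ N : ℕ, z ∈ closure (⋃ j ≥ N, Z (κ j))) ∧
      (∀ z ∈ W, ∀ V ∈ 𝓝 z, ∀ᶠ j in atTop, (Z (κ j) ∩ V).Nonempty) ∧
      (∀ U : Set (ComplexTorus Φ), IsOpen U → W ⊆ U → ∀ᶠ j in atTop, Z (κ j) ⊆ U) ∧
      ∃ N, ∀ j ≥ N, analyticCycleClass Φ e h (hZ (κ j)) = analyticCycleClass Φ e h (hZ (κ N)) := by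
  obtain ⟨T, κ, hκ, hconv, -⟩ := exists_subseq_tendsto_analyticChain Φ hZ hM hvol
  refine ⟨κ, cover Φ '' (((↑) : (⊤ : Opens E) → E) '' T.support), hκ,
    isClosed_image_cover_support Φ (fun j ↦ hZ (κ j)) hconv,
    isAnalyticSet_image_cover_support Φ (fun j ↦ hZ (κ j)) hconv,
    image_cover_support_eq_empty_or_hasPureDim Φ (fun j ↦ hZ (κ j)) hconv,
    mem_image_cover_support_iff_of_tendsto Φ (fun j ↦ hZ (κ j)) hconv,
    fun z hz V hV ↦ eventually_nonempty_inter_of_tendsto Φ (fun j ↦ hZ (κ j)) hconv hz hV,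
    fun U hU hWU ↦ eventually_subset_of_isOpen_of_tendsto Φ (fun j ↦ hZ (κ j)) hconv hU hWU,
    eventually_analyticCycleClass_eq_of_tendsto_current Φ e h (fun j ↦ hZ (κ j)) hconv⟩

end Package

end ComplexTorus

end Literature.Geometry.Kaehler

end
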